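import Summits.NavierStokesRegularity.NavierStokesRegularity.Theses.OddMorawetz

/-!
# Jet decay for `OddMorawetzLocal` (stmt-NavierStokesRegularity-1376), I: cutoffs, shells, majorants

Support file for the birth-skeleton stub `stub_jetDecay` of the crux `OddMorawetzLocal` (`|x|⁻⁴` decay of the jets
of the Euler bilinear term `B(v,v)` of a divergence-free Schwartz field on `ℝ³`; T. Tao, J. Amer. Math. Soc. 29
(2016), §1.1, display after (1.8): `P div(v ⊗ v) = O(|x|^{-d-1})`).  The decay is proved on the Fourier side by a
kernel estimate for symbols `F` smooth off the origin with `|ξ|ᵐ ‖DᵐF(ξ)‖ ≤ Cₘ|ξ|` on the unit ball and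
`|ξ|⁴ ‖DᵐF(ξ)‖ ≤ C'ₘ` off it: for `|x| = R ≥ 1` one splits `F = χ(R·)F + (1 - χ(R·))F` with a smooth cutoff `χ` and
integrates by parts five times in the second piece (file `…JetDecayKernel`).  This file supplies the elementary
ingredients: a smooth cutoff with bounded derivatives and the derivatives of its rescalings (`exists_smooth_cutoff`,
`norm_iteratedFDeriv_comp_smul_le`), Japanese-bracket comparisons, the pointwise bounds of `DᵐF` on the shells
`|ξ| ≥ (2R)⁻¹` and `(2R)⁻¹ ≤ |ξ| ≤ R⁻¹`, and the `L¹` norm `O(R)` of the resulting majorant (`integral_majorant_le`,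
scaling of Lebesgue measure).  Everything is proved; no definitions.
-/

noncomputable section

open MeasureTheory Filter Topology Set FourierTransform Metric Complex VectorFourier
open Literature.Analysis Literature.Analysis.FluidPDE
open scoped Real RealInnerProductSpace ContDiff SchwartzMap LineDeriv

-- the problem namespace `Summit.NavierStokesRegularity.NavierStokesRegularity` repeats the summit name by design (D-0017)
set_option linter.dupNamespace false

namespace Summit.NavierStokesRegularity.NavierStokesRegularity.Theorems

namespace JetDecay

/-- Frequency / physical space `ℝ³`. -/
local notation "E3" => EuclideanSpace ℝ (Fin 3)

/-! ### A smooth cutoff and its rescalings -/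

/-- A smooth cutoff on `ℝ³`: `χ = 1` on the ball of radius `1/2`, `χ = 0` outside the open unit ball,
`0 ≤ χ ≤ 1`, and every derivative of `χ` is bounded. -/
theorem exists_smooth_cutoff :
    ∃ χ : E3 → ℝ, ContDiff ℝ ∞ χ ∧ (∀ η, ‖η‖ ≤ 2⁻¹ → χ η = 1) ∧ (∀ η, 1 ≤ ‖η‖ → χ η = 0) ∧
      (∀ η, 0 ≤ χ η ∧ χ η ≤ 1) ∧ ∀ i : ℕ, ∃ M, ∀ η, ‖iteratedFDeriv ℝ i χ η‖ ≤ M := by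
  let b : ContDiffBump (0 : E3) := ⟨2⁻¹, 1, by norm_num, by norm_num⟩
  refine ⟨b, b.contDiff, fun η hη => ?_, fun η hη => ?_, fun η => ⟨b.nonneg, b.le_one⟩,
    fun i => ?_⟩
  · exact b.one_of_mem_closedBall (by simpa using hη)
  · exact b.zero_of_le_dist (by simpa using hη)
  · have hc : Continuous (iteratedFDeriv ℝ i (b : E3 → ℝ)) :=
      b.contDiff.continuous_iteratedFDeriv (by exact_mod_cast le_top)
    have hs : HasCompactSupport (iteratedFDeriv ℝ i (b : E3 → ℝ)) :=
      b.hasCompactSupport.iteratedFDeriv i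
    exact hc.bounded_above_of_compact_support hs

/-- Derivatives of the rescaled cutoff `ξ ↦ χ(Rξ)`: `‖Dⁱ[χ(R·)](ξ)‖ ≤ Mᵢ Rⁱ`. -/
theorem norm_iteratedFDeriv_comp_smul_le {χ : E3 → ℝ} (hχ : ContDiff ℝ ∞ χ) {i : ℕ} {M : ℝ}
    (hM : ∀ η, ‖iteratedFDeriv ℝ i χ η‖ ≤ M) {R : ℝ} (hR : 0 ≤ R) (ξ : E3) :
    ‖iteratedFDeriv ℝ i (fun η => χ (R • η)) ξ‖ ≤ M * R ^ i := by
  have hA : (fun η => χ (R • η)) = χ ∘ (R • ContinuousLinearMap.id ℝ E3) := by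
    funext η; simp
  rw [hA, ContinuousLinearMap.iteratedFDeriv_comp_right _ hχ _ (by exact_mod_cast le_top)]
  refine (ContinuousMultilinearMap.norm_compContinuousLinearMap_le _ _).trans ?_
  simp only [Finset.prod_const, Finset.card_univ, Fintype.card_fin]
  have hM0 : 0 ≤ M := (norm_nonneg _).trans (hM 0)
  have hn : ‖R • ContinuousLinearMap.id ℝ E3‖ ≤ R := by
    rw [norm_smul, Real.norm_of_nonneg hR]
    exact mul_le_of_le_one_right hR ContinuousLinearMap.norm_id_le
  gcongr
  exact hM _

/-- The rescaled cutoff is locally constant off the ball of radius `R⁻¹`, so its derivatives vanish there. -/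
theorem iteratedFDeriv_comp_smul_eq_zero {χ : E3 → ℝ} (hχ0 : ∀ η, 1 ≤ ‖η‖ → χ η = 0)
    {R : ℝ} (hR : 0 < R) {ξ : E3} (hξ : R⁻¹ < ‖ξ‖) (i : ℕ) :
    iteratedFDeriv ℝ i (fun η => χ (R • η)) ξ = 0 := by
  have h : (fun η => χ (R • η)) =ᶠ[𝓝 ξ] fun _ => (0 : ℝ) := by
    have ho : IsOpen {η : E3 | R⁻¹ < ‖η‖} := isOpen_lt continuous_const continuous_norm
    filter_upwards [ho.mem_nhds hξ] with η hη
    apply hχ0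
    rw [norm_smul, Real.norm_of_nonneg hR.le]
    have h1 := mul_lt_mul_of_pos_left hη hR
    rw [mul_inv_cancel₀ hR.ne'] at h1
    exact h1.le
  rw [(h.iteratedFDeriv ℝ i).eq_of_nhds, iteratedFDeriv_fun_zero]
  rfl

/-- The rescaled cutoff is `1` near every point of the open ball of radius `(2R)⁻¹`. -/
theorem comp_smul_eventuallyEq_one {χ : E3 → ℝ} (hχ1 : ∀ η, ‖η‖ ≤ 2⁻¹ → χ η = 1)
    {R : ℝ} (hR : 0 < R) {ξ : E3} (hξ : ‖ξ‖ < (2 * R)⁻¹) :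
    (fun η => χ (R • η)) =ᶠ[𝓝 ξ] fun _ => (1 : ℝ) := by
  have ho : IsOpen {η : E3 | ‖η‖ < (2 * R)⁻¹} := isOpen_lt continuous_norm continuous_const
  filter_upwards [ho.mem_nhds hξ] with η hη
  apply hχ1
  rw [norm_smul, Real.norm_of_nonneg hR.le]
  have h1 := mul_lt_mul_of_pos_left hη hR
  rw [mul_inv, ← mul_assoc, mul_comm R 2⁻¹, mul_assoc, mul_inv_cancel₀ hR.ne', mul_one] at h1
  exact h1.le

/-! ### Japanese-bracket comparisons -/

/-- On the unit ball, `1 ≤ 16 (1 + |ξ|)⁻⁴`. -/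
theorem one_le_sixteen_mul_rpow {ξ : E3} (h : ‖ξ‖ ≤ 1) : (1 : ℝ) ≤ 16 * (1 + ‖ξ‖) ^ (-(4 : ℝ)) := by
  have h0 : 0 < 1 + ‖ξ‖ := by positivity
  rw [Real.rpow_neg h0.le, show (4 : ℝ) = (4 : ℕ) by norm_num, Real.rpow_natCast]
  rw [← div_eq_mul_inv, le_div_iff₀ (by positivity), one_mul]
  have h2 : 1 + ‖ξ‖ ≤ 2 := by linarith
  calc (1 + ‖ξ‖) ^ 4 ≤ (2 : ℝ) ^ 4 := by gcongr
    _ = 16 := by norm_num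

/-- Off the unit ball, `|η|⁻⁴ ≤ 16 (1 + |η|)⁻⁴`. -/
theorem inv_pow_four_le_sixteen_mul_rpow {η : E3} (h : 1 ≤ ‖η‖) :
    (‖η‖ ^ 4)⁻¹ ≤ 16 * (1 + ‖η‖) ^ (-(4 : ℝ)) := by
  have h0 : 0 < 1 + ‖η‖ := by positivity
  have h1 : 0 < ‖η‖ := by linarith
  rw [Real.rpow_neg h0.le, show (4 : ℝ) = (4 : ℕ) by norm_num, Real.rpow_natCast]
  have hle : (1 + ‖η‖) ^ 4 / 16 ≤ ‖η‖ ^ 4 := by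
    rw [div_le_iff₀ (by norm_num : (0 : ℝ) < 16)]
    have h2 : 1 + ‖η‖ ≤ 2 * ‖η‖ := by linarith
    calc (1 + ‖η‖) ^ 4 ≤ (2 * ‖η‖) ^ 4 := by gcongr
      _ = ‖η‖ ^ 4 * 16 := by ring
  calc (‖η‖ ^ 4)⁻¹ ≤ ((1 + ‖η‖) ^ 4 / 16)⁻¹ := inv_anti₀ (by positivity) hle
    _ = 16 * ((1 + ‖η‖) ^ 4)⁻¹ := by rw [inv_div]; ring

/-! ### Pointwise bounds on shells -/

/-- From the unit-ball and far-field symbol estimates of order `m ≤ 5`: `‖DᵐF(ξ)‖ ≤ (Cₘ + C'ₘ) |ξ|⁻⁴` for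
`ξ ≠ 0`. -/
theorem norm_iteratedFDeriv_le_inv_pow_four {F : E3 → ℂ} {m : ℕ} (hm : m ≤ 5) {Cn Cf : ℝ}
    (hCn0 : 0 ≤ Cn) (hCf0 : 0 ≤ Cf)
    (hCn : ∀ ξ : E3, ξ ≠ 0 → ‖ξ‖ ≤ 1 → ‖ξ‖ ^ m * ‖iteratedFDeriv ℝ m F ξ‖ ≤ Cn * ‖ξ‖)
    (hCf : ∀ ξ : E3, 1 ≤ ‖ξ‖ → ‖ξ‖ ^ 4 * ‖iteratedFDeriv ℝ m F ξ‖ ≤ Cf)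
    {ξ : E3} (hξ : ξ ≠ 0) :
    ‖iteratedFDeriv ℝ m F ξ‖ ≤ (Cn + Cf) * (‖ξ‖ ^ 4)⁻¹ := by
  set A := ‖iteratedFDeriv ℝ m F ξ‖ with hA
  have ht : 0 < ‖ξ‖ := norm_pos_iff.2 hξ
  rw [← div_eq_mul_inv, le_div_iff₀ (pow_pos ht 4)]
  rcases le_or_gt ‖ξ‖ 1 with h1 | h1
  · have hp : ‖ξ‖ ^ 5 ≤ ‖ξ‖ ^ m := pow_le_pow_of_le_one ht.le h1 hm
    have h2 : ‖ξ‖ ^ 5 * A ≤ Cn * ‖ξ‖ :=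
      (mul_le_mul_of_nonneg_right hp (norm_nonneg _)).trans (hCn ξ hξ h1)
    have h3 : ‖ξ‖ * (A * ‖ξ‖ ^ 4) ≤ ‖ξ‖ * Cn := by
      calc ‖ξ‖ * (A * ‖ξ‖ ^ 4) = ‖ξ‖ ^ 5 * A := by ring
        _ ≤ Cn * ‖ξ‖ := h2
        _ = ‖ξ‖ * Cn := by ring
    have h4 : A * ‖ξ‖ ^ 4 ≤ Cn := le_of_mul_le_mul_left h3 ht
    linarith
  · have h2 := hCf ξ h1.le
    linarith

/-- On the annulus `(2R)⁻¹ ≤ |ξ| ≤ R⁻¹` (`R ≥ 1`): `‖DʲF(ξ)‖ ≤ Cⱼ R⁻¹ (2R)ʲ`. -/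
theorem norm_iteratedFDeriv_le_on_annulus {F : E3 → ℂ} {j : ℕ} {Cn : ℝ} (hCn0 : 0 ≤ Cn)
    (hCn : ∀ ξ : E3, ξ ≠ 0 → ‖ξ‖ ≤ 1 → ‖ξ‖ ^ j * ‖iteratedFDeriv ℝ j F ξ‖ ≤ Cn * ‖ξ‖)
    {R : ℝ} (hR : 1 ≤ R) {ξ : E3} (h1 : (2 * R)⁻¹ ≤ ‖ξ‖) (h2 : ‖ξ‖ ≤ R⁻¹) :
    ‖iteratedFDeriv ℝ j F ξ‖ ≤ Cn * R⁻¹ * (2 * R) ^ j := by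
  set A := ‖iteratedFDeriv ℝ j F ξ‖ with hA
  have hR0 : 0 < R := by linarith
  have h2R : 0 < 2 * R := by positivity
  have ht : 0 < ‖ξ‖ := lt_of_lt_of_le (by positivity) h1
  have hξ : ξ ≠ 0 := norm_pos_iff.1 ht
  have ht1 : ‖ξ‖ ≤ 1 := h2.trans (inv_le_one_of_one_le₀ hR)
  have key : ‖ξ‖ ^ j * A ≤ Cn * R⁻¹ := (hCn ξ hξ ht1).trans (by gcongr)
  have hone : (1 : ℝ) ≤ (2 * R) ^ j * ‖ξ‖ ^ j := by
    have h3 : (2 * R)⁻¹ ^ j ≤ ‖ξ‖ ^ j := pow_le_pow_left₀ (by positivity) h1 j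
    calc (1 : ℝ) = (2 * R) ^ j * (2 * R)⁻¹ ^ j := by
          rw [inv_pow, mul_inv_cancel₀ (pow_ne_zero j h2R.ne')]
      _ ≤ (2 * R) ^ j * ‖ξ‖ ^ j := by gcongr
  calc A = A * 1 := (mul_one A).symm
    _ ≤ A * ((2 * R) ^ j * ‖ξ‖ ^ j) := mul_le_mul_of_nonneg_left hone (norm_nonneg _)
    _ = (2 * R) ^ j * (‖ξ‖ ^ j * A) := by ring
    _ ≤ (2 * R) ^ j * (Cn * R⁻¹) := by gcongr
    _ = Cn * R⁻¹ * (2 * R) ^ j := by ring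

/-! ### Lebesgue measure on `ℝ³`: the Japanese bracket and the `L¹` norm of the majorant -/

/-- `ℝ³` has dimension `3` (for the scaling of Lebesgue measure). -/
theorem finrank_E3 : Module.finrank ℝ E3 = 3 := finrank_euclideanSpace_fin

/-- The Japanese bracket `(1 + |η|)⁻⁴` is integrable on `ℝ³`. -/
theorem integrable_japaneseBracket : Integrable (fun η : E3 => (1 + ‖η‖) ^ (-(4 : ℝ))) := by
  refine integrable_one_add_norm ?_
  rw [finrank_E3]; norm_num

/-- Integral of the majorant of `Dᵐ[(1 - χ(R·))F]`: it is `O(R)` (scaling of Lebesgue measure). -/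
theorem integral_majorant_le {K L : ℝ} (hL : 0 ≤ L) {R : ℝ} (hR : 1 ≤ R) {m : ℕ}
    (hm : m ≤ 5) :
    Integrable (fun ξ : E3 => K * (16 * (2 * R) ^ 4 * (1 + ‖(2 * R) • ξ‖) ^ (-(4 : ℝ))) +
      L * (R ^ m * R⁻¹) * (closedBall (0 : E3) R⁻¹).indicator (fun _ => (1 : ℝ)) ξ) ∧
    ∫ ξ : E3, (K * (16 * (2 * R) ^ 4 * (1 + ‖(2 * R) • ξ‖) ^ (-(4 : ℝ))) +
      L * (R ^ m * R⁻¹) * (closedBall (0 : E3) R⁻¹).indicator (fun _ => (1 : ℝ)) ξ) ≤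
      (K * (32 * ∫ η : E3, (1 + ‖η‖) ^ (-(4 : ℝ))) + L * (volume : Measure E3).real (ball 0 1)) * R := by
  have hR0 : 0 < R := by linarith
  have h2R : (2 * R) ≠ 0 := by positivity
  set I : ℝ := ∫ η : E3, (1 + ‖η‖) ^ (-(4 : ℝ)) with hI
  -- the rescaled Japanese bracket
  have h1i : Integrable (fun ξ : E3 => (1 + ‖(2 * R) • ξ‖) ^ (-(4 : ℝ))) :=
    integrable_japaneseBracket.comp_smul h2R
  have h1 : ∫ ξ : E3, (1 + ‖(2 * R) • ξ‖) ^ (-(4 : ℝ)) = ((2 * R) ^ 3)⁻¹ * I := by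
    have h := Measure.integral_comp_smul (volume : Measure E3)
      (fun η : E3 => (1 + ‖η‖) ^ (-(4 : ℝ))) (2 * R)
    rw [finrank_E3] at h
    rw [h, smul_eq_mul, abs_of_pos (by positivity)]
  -- the indicator
  have h2i : Integrable (fun ξ : E3 => (closedBall (0 : E3) R⁻¹).indicator (fun _ => (1 : ℝ)) ξ) :=
    (integrableOn_const (measure_closedBall_lt_top.ne)).integrable_indicator measurableSet_closedBall
  have h2 : ∫ ξ : E3, (closedBall (0 : E3) R⁻¹).indicator (fun _ => (1 : ℝ)) ξ =
      R⁻¹ ^ 3 * (volume : Measure E3).real (ball 0 1) := by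
    rw [integral_indicator_const _ measurableSet_closedBall, smul_eq_mul, mul_one,
      Measure.addHaar_real_closedBall _ _ (by positivity), finrank_E3]
  have hA : Integrable (fun ξ : E3 => K * (16 * (2 * R) ^ 4 * (1 + ‖(2 * R) • ξ‖) ^ (-(4 : ℝ)))) :=
    (h1i.const_mul (16 * (2 * R) ^ 4)).const_mul K
  have hB : Integrable (fun ξ : E3 =>
      L * (R ^ m * R⁻¹) * (closedBall (0 : E3) R⁻¹).indicator (fun _ => (1 : ℝ)) ξ) :=
    h2i.const_mul (L * (R ^ m * R⁻¹))
  refine ⟨hA.add hB, ?_⟩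
  rw [integral_add hA hB, integral_const_mul, integral_const_mul, integral_const_mul, h1, h2]
  have hv : 0 ≤ (volume : Measure E3).real (ball 0 1) := measureReal_nonneg
  have hI0 : 0 ≤ I := integral_nonneg fun η => by positivity
  have hpow : R ^ m * R⁻¹ * R⁻¹ ^ 3 ≤ R := by
    have h5 : R ^ m ≤ R ^ 5 := pow_le_pow_right₀ hR hm
    calc R ^ m * R⁻¹ * R⁻¹ ^ 3 = R ^ m * (R ^ 4)⁻¹ := by ring
      _ ≤ R ^ 5 * (R ^ 4)⁻¹ := by gcongr
      _ = R := by field_simp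
  have hsc : (16 : ℝ) * (2 * R) ^ 4 * ((2 * R) ^ 3)⁻¹ = 32 * R := by
    field_simp
    ring
  calc K * (16 * (2 * R) ^ 4 * (((2 * R) ^ 3)⁻¹ * I)) +
        L * (R ^ m * R⁻¹) * (R⁻¹ ^ 3 * (volume : Measure E3).real (ball 0 1))
      = K * (32 * I) * R + L * (volume : Measure E3).real (ball 0 1) * (R ^ m * R⁻¹ * R⁻¹ ^ 3) := by
        linear_combination (K * I) * hsc
    _ ≤ K * (32 * I) * R + L * (volume : Measure E3).real (ball 0 1) * R := by gcongr
    _ = (K * (32 * I) + L * (volume : Measure E3).real (ball 0 1)) * R := by ring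

end JetDecay

/-- **Helper sub-goal `stub_jetDecay_cutoff`** (registered on the crux item as a sub-goal of `stub_jetDecay`): a smooth
cutoff on `ℝ³` equal to `1` on the ball of radius `1/2`, vanishing off the unit ball, with values in `[0,1]` and all
derivatives bounded (`JetDecay.exists_smooth_cutoff`). -/
theorem stub_jetDecay_cutoff :
    ∃ χ : EuclideanSpace ℝ (Fin 3) → ℝ, ContDiff ℝ (⊤ : ℕ∞) χ ∧ (∀ η, ‖η‖ ≤ 2⁻¹ → χ η = 1) ∧ (∀ η, 1 ≤ ‖η‖ → χ η
      = 0) ∧ (∀ η, 0 ≤ χ η ∧ χ η ≤ 1) ∧ ∀ i : ℕ, ∃ M : ℝ, ∀ η, ‖iteratedFDeriv ℝ i χ η‖ ≤ M :=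
  JetDecay.exists_smooth_cutoff

end Summit.NavierStokesRegularity.NavierStokesRegularity.Theorems
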